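import Summits.Parity.BatemanHorn.Theorems.SystemLSDRealSegment.Negative.Engines
import Literature.NumberTheory.Sieve.BatemanHorn

/-!
# `SystemLSDRealSegment` — the un-capped `Ω` variant is false on any real segment crossing `y = 2`

A refuted natural strengthening of the crux `Summit.Parity.BatemanHorn.Theses.AlmostPrimeZeros.SystemLSDRealSegment`
(stmt-Parity-11292), from the standing disprover's work file `Cruxes/SystemLSDRealSegment/Disproof.lean` §5.

The crux uses the CAPPED statistic `s_f(n) = Σ_i Σ_{p^v ∥ f_i(n)} min(v, 2)`, whose local Euler factors are
polynomials in `y`; for the un-capped `Ω` the `p = 2` factor `Σ_v (y/2)^v` has a pole at `y = 2`. On the crux's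
segment `(5/4, 7/4)` the Ω-law is still conjecturally true (sibling crux `SelbergDelangeRigidity.LSDRealSegment`),
but with the segment widened to `(5/4, 5/2)` it is FALSE already for the Bateman–Horn system `f = X`: at
`y = 9/4`, along `x = 2^m`, the single term `n = 2^m` gives a normalised sum `≥ (9/8)^m / (m log 2)² → ∞`
(`not_omegaLawWide`). The cap `min v 2` is exactly what removes the wall at `2`.
-/

open Filter Polynomial Finset
open scoped Topology

namespace Summit.Parity.BatemanHorn.Theorems.SystemLSDRealSegment.Negative

open Literature.NumberTheory.Sieve

/-- `ω_X(p) = 1`. [folklore] -/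
theorem polyRootCountMod_X {p : ℕ} (hp : p.Prime) : polyRootCountMod (![X] : Fin 1 → ℤ[X]) p = 1 := by
  unfold polyRootCountMod
  have : ((Finset.range p).filter fun n : ℕ => (p : ℤ) ∣ ∏ i, ((![X] : Fin 1 → ℤ[X]) i).eval (n : ℤ)) = {0} := by
    ext n
    simp only [Finset.mem_filter, Finset.mem_range, Finset.mem_singleton, Fin.prod_univ_one,
      Matrix.cons_val_fin_one, eval_X, Int.natCast_dvd_natCast]
    constructor
    · rintro ⟨hn, hdvd⟩
      exact Nat.eq_zero_of_dvd_of_lt hdvd hn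
    · rintro rfl
      exact ⟨hp.pos, dvd_zero p⟩
  rw [this, Finset.card_singleton]

/-- `![X]` is a Bateman–Horn system. [folklore] -/
theorem isBatemanHornSystem_X : IsBatemanHornSystem (![X] : Fin 1 → ℤ[X]) where
  irreducible i := by simpa using Polynomial.prime_X.irreducible
  leadingCoeff_pos i := by simp
  pairwise_not_associated := Subsingleton.pairwise
  hasNoFixedPrimeDivisor p hp := by rw [polyRootCountMod_X hp]; exact hp.one_lt

/-- `Ω(2^m) = m` for the family `![X]`. [folklore] -/
theorem statΩ_X_two_pow (m : ℕ) : (∑ i, ((((![X] : Fin 1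
    → ℤ[X]) i).eval ((2 ^ m : ℕ) : ℤ)).toNat.factorization.sum fun _ v => v)) = m := by
  simp only [Fin.sum_univ_one, Matrix.cons_val_fin_one, eval_X, Int.toNat_natCast]
  rw [Nat.prime_two.factorization_pow, Finsupp.sum_single_index rfl]

/-- Lower bound along `x = 2^m` at `y = 9/4` for the real Ω-normalised sum of `![X]`:
`≥ (9/8)^m / (m log 2)²` (keep the single term `n = 2^m`; `(log 2^m)^{1-y} = (m log 2)^{-5/4} ≥ (m log 2)^{-2}`).
[folklore] -/
theorem omegaSum_X_two_pow_ge {m : ℕ} (hm : 2 ≤ m) :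
    (9 / 8 : ℝ) ^ m / ((m : ℝ) * Real.log 2) ^ 2 ≤
      ((2 ^ m : ℕ) : ℝ)⁻¹ * Real.exp ((1 : ℕ) * (1 - (9 / 4 : ℝ)) * Real.log (Real.log ((2 ^ m : ℕ) : ℝ))) *
        ∑ n ∈ Finset.range (2 ^ m + 1), (9 / 4 : ℝ) ^ (∑ i, ((((![X] : Fin 1
            → ℤ[X]) i).eval (n : ℤ)).toNat.factorization.sum fun _ v => v)) := by
  have hlog2 : (1 : ℝ) / 2 < Real.log 2 := by have := Real.log_two_gt_d9; linarith
  have hm' : (2 : ℝ) ≤ m := by exact_mod_cast hm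
  have ht : 1 ≤ (m : ℝ) * Real.log 2 := by nlinarith
  have ht0 : 0 < (m : ℝ) * Real.log 2 := by linarith
  have hlogpow : Real.log ((2 ^ m : ℕ) : ℝ) = m * Real.log 2 := by push_cast; rw [Real.log_pow]
  have hexp : Real.exp ((1 : ℕ) * (1 - (9 / 4 : ℝ)) * Real.log (Real.log ((2 ^ m : ℕ) : ℝ))) =
      ((m : ℝ) * Real.log 2) ^ (-(5 / 4) : ℝ) := by
    rw [hlogpow, Real.rpow_def_of_pos ht0]
    congr 1
    push_cast
    ring
  have hexp_ge : (((m : ℝ) * Real.log 2) ^ 2)⁻¹ ≤ ((m : ℝ) * Real.log 2) ^ (-(5 / 4) : ℝ) := by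
    rw [← Real.rpow_natCast, ← Real.rpow_neg ht0.le]
    exact Real.rpow_le_rpow_of_exponent_le ht (by norm_num)
  have hsum : (9 / 4 : ℝ) ^ m ≤ ∑ n ∈ Finset.range (2 ^ m + 1), (9 / 4 : ℝ) ^ (∑ i, ((((![X] : Fin 1
      → ℤ[X]) i).eval (n : ℤ)).toNat.factorization.sum fun _ v => v)) := by
    have e : (∑ i, ((((![X] : Fin 1 → ℤ[X]) i).eval ((2 ^ m : ℕ) : ℤ)).toNat.factorization.sum
        fun _ v => v)) = m := statΩ_X_two_pow m
    have := Finset.single_le_sum (f := fun n : ℕ => (9 / 4 : ℝ) ^ (∑ i, ((((![X] : Fin 1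
        → ℤ[X]) i).eval (n : ℤ)).toNat.factorization.sum fun _ v => v)))
      (fun _ _ => by positivity) (Finset.mem_range.2 (Nat.lt_succ_self (2 ^ m)))
    rwa [e] at this
  have hx : ((2 ^ m : ℕ) : ℝ)⁻¹ = (1 / 2 : ℝ) ^ m := by push_cast; simp
  calc (9 / 8 : ℝ) ^ m / ((m : ℝ) * Real.log 2) ^ 2
      = (1 / 2 : ℝ) ^ m * (((m : ℝ) * Real.log 2) ^ 2)⁻¹ * (9 / 4 : ℝ) ^ m := by
        rw [div_eq_mul_inv, show (9 / 8 : ℝ) = 1 / 2 * (9 / 4) by norm_num, mul_pow]; ring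
    _ ≤ (1 / 2 : ℝ) ^ m * ((m : ℝ) * Real.log 2) ^ (-(5 / 4) : ℝ) *
          ∑ n ∈ Finset.range (2 ^ m + 1), (9 / 4 : ℝ) ^ (∑ i, ((((![X] : Fin 1
              → ℤ[X]) i).eval (n : ℤ)).toNat.factorization.sum fun _ v => v)) := by
        gcongr
    _ = _ := by rw [hx, hexp]

/-- `(9/8)^m / (m log 2)² → ∞`. [folklore] -/
theorem tendsto_geom_div_sq : Tendsto (fun m : ℕ => (9 / 8 : ℝ) ^ m / ((m : ℝ) * Real.log 2) ^ 2) atTop atTop := by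
  have h0 : Tendsto (fun m : ℕ => (m : ℝ) ^ 2 / (9 / 8 : ℝ) ^ m) atTop (𝓝[>] 0) := by
    refine tendsto_nhdsWithin_iff.2 ⟨tendsto_pow_const_div_const_pow_of_one_lt 2 (by norm_num), ?_⟩
    filter_upwards [eventually_ge_atTop 1] with m hm
    simp only [Set.mem_Ioi]
    positivity
  have h1 := h0.inv_tendsto_nhdsGT_zero
  have h2 := h1.const_mul_atTop (by have := Real.log_two_gt_d9; positivity : (0 : ℝ) < (Real.log 2 ^ 2)⁻¹)
  refine h2.congr' ?_
  filter_upwards [eventually_ge_atTop 1] with m hm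
  have hm0 : (m : ℝ) ≠ 0 := by exact_mod_cast (show m ≠ 0 by omega)
  have hl : Real.log 2 ≠ 0 := by have := Real.log_two_gt_d9; positivity
  simp only [Pi.inv_apply]
  field_simp

/-- THE Ω-VARIANT ON A SEGMENT CROSSING 2 IS FALSE: the crux with `min v 2` replaced by `v`, the segment
`(5/4, 7/4)` by `(5/4, 5/2)` and the ball radius `2` by `3` fails — witness `k = 1`, `f = ![X]` (a Bateman–Horn
system), `y = 9/4`, `x = 2^m` (`(9/8)^m/(m log 2)² → ∞` contradicts convergence along the subsequence).
[folklore] -/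
theorem not_omegaLawWide :
    ¬ ∀ (k : ℕ) (f : Fin k → ℤ[X]), IsBatemanHornSystem f → ∃ Λ : ℂ → ℂ, DifferentiableOn ℂ Λ (Metric.ball 0 3) ∧
      Λ 0 = (batemanHornConst f : ℂ) ∧ ∀ y : ℝ, 5 / 4 < y → y < 5 / 2 →
        Filter.Tendsto (fun x : ℕ => (x : ℂ)⁻¹
            * Complex.exp ((k : ℂ) * (1 - (y : ℂ)) * (Real.log (Real.log x) : ℂ)) *
          ∑ n ∈ Finset.range (x + 1), (y : ℂ) ^ (∑ i, (((f i).eval (n : ℤ)).toNat.factorization.sum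
              fun _ v => v))) Filter.atTop
          (nhds (Λ y * Complex.exp (((y : ℂ) - 1) * (Real.log (∏ i, ((f i).natDegree : ℝ)) : ℂ)) *
            (Complex.Gamma y)⁻¹ ^ k)) := by
  intro h
  obtain ⟨Λ, _, _, hlaw⟩ := h 1 ![X] isBatemanHornSystem_X
  have hofReal : ∀ x : ℕ, (x : ℂ)⁻¹ * Complex.exp (((1 : ℕ) : ℂ) * (1 - ((9 / 4 : ℝ) : ℂ)) *
      (Real.log (Real.log x) : ℂ)) * ∑ n ∈ Finset.range (x + 1), ((9 / 4 : ℝ) : ℂ) ^ (∑ i, ((((![X] : Fin 1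
          → ℤ[X]) i).eval (n : ℤ)).toNat.factorization.sum fun _ v => v)) =
      (((x : ℝ)⁻¹ * Real.exp ((1 : ℕ) * (1 - (9 / 4 : ℝ)) * Real.log (Real.log x)) *
        ∑ n ∈ Finset.range (x + 1), (9 / 4 : ℝ) ^ (∑ i, ((((![X] : Fin 1
            → ℤ[X]) i).eval (n : ℤ)).toNat.factorization.sum fun _ v => v)) : ℝ) : ℂ) := fun x => by
    push_cast
    rfl
  have hlim := (hlaw (9 / 4) (by norm_num) (by norm_num)).congr hofReal
  have hre := tendsto_re_of_tendsto_ofReal hlim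
  have h2m : Tendsto (fun m : ℕ => 2 ^ m) atTop atTop := tendsto_pow_atTop_atTop_of_one_lt one_lt_two
  refine not_tendsto_atTop_of_tendsto_nhds (hre.comp h2m) ?_
  refine tendsto_atTop_mono' atTop ?_ tendsto_geom_div_sq
  filter_upwards [eventually_ge_atTop 2] with m hm
  exact omegaSum_X_two_pow_ge hm

end Summit.Parity.BatemanHorn.Theorems.SystemLSDRealSegment.Negative
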